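import Summits.KontsevichZagierPeriods.Zeta5Search.LaiSweepShard

/-!
# `κ₃` sweep certificate — shard file 124 of 127 (shards 868–874 of 889)

HONEST FRAMING. Systematic search; no irrationality claim unless certified. This file only checks,
by `decide +kernel`, shards 868–874 of the order-cell sweep of the `κ₃` point `(74, 2180, 444; δ74)`
(engine `LaiSweepEngine`, soundness `LaiSweepJump/Free/Eval/Shard/Kappa3`; a shard is `⟨regime, n,
p, q, p', q', Lo, Up⟩`: `n` cells from `p/q` to `p'/q'` with integer rate sums in `[Lo, Up]`, `K =
128`, `D = 2^40`). It draws NO conclusion: only the capstone `LaiKappa3SweepCert`, which needs all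
127 shard files, does. Kernel cost of this file ≈ 560 cells × 0.3 s.
-/

namespace Summit.KontsevichZagierPeriods.Zeta5Search.Sweep

set_option maxHeartbeats 100000000 in
/-- Shard 868: 80 cells of regime B from `75/77` to `433/444`.
[cite: Lai2024BallRivoal, §4 Lemma 4.3] -/
theorem shard868 :
    Shard.check 128 (2^40)
      ⟨true, 80, 75, 77, 433, 444, 9584199705492, 17207666697337⟩ = true := by
  decide +kernel

set_option maxHeartbeats 100000000 in
/-- Shard 869: 80 cells of regime B from `433/444` to `333/341`.
[cite: Lai2024BallRivoal, §4 Lemma 4.3] -/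
theorem shard869 :
    Shard.check 128 (2^40)
      ⟨true, 80, 433, 444, 333, 341, 10503867911945, 18878028521866⟩ = true := by
  decide +kernel

set_option maxHeartbeats 100000000 in
/-- Shard 870: 80 cells of regime B from `333/341` to `353/361`.
[cite: Lai2024BallRivoal, §4 Lemma 4.3] -/
theorem shard870 :
    Shard.check 128 (2^40)
      ⟨true, 80, 333, 341, 353, 361, 10371322946542, 18659500566676⟩ = true := by
  decide +kernel

set_option maxHeartbeats 100000000 in
/-- Shard 871: 80 cells of regime B from `353/361` to `187/191`.
[cite: Lai2024BallRivoal, §4 Lemma 4.3] -/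
theorem shard871 :
    Shard.check 128 (2^40)
      ⟨true, 80, 353, 361, 187, 191, 9722541472205, 17510023238724⟩ = true := by
  decide +kernel

set_option maxHeartbeats 100000000 in
/-- Shard 872: 80 cells of regime B from `187/191` to `249/254`.
[cite: Lai2024BallRivoal, §4 Lemma 4.3] -/
theorem shard872 :
    Shard.check 128 (2^40)
      ⟨true, 80, 187, 191, 249, 254, 10020713296554, 18065055114303⟩ = true := by
  decide +kernel

set_option maxHeartbeats 100000000 in
/-- Shard 873: 80 cells of regime B from `249/254` to `266/271`.
[cite: Lai2024BallRivoal, §4 Lemma 4.3] -/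
theorem shard873 :
    Shard.check 128 (2^40)
      ⟨true, 80, 249, 254, 266, 271, 9844518005088, 17765273824178⟩ = true := by
  decide +kernel

set_option maxHeartbeats 100000000 in
/-- Shard 874: 80 cells of regime B from `266/271` to `343/349`.
[cite: Lai2024BallRivoal, §4 Lemma 4.3] -/
theorem shard874 :
    Shard.check 128 (2^40)
      ⟨true, 80, 266, 271, 343, 349, 10017339128264, 18095322480921⟩ = true := by
  decide +kernel

/-- The checked shards of this file, in order. [folklore] -/
def shards124 : List (CheckedShard 128 (2^40)) :=
  [⟨_, shard868⟩, ⟨_, shard869⟩, ⟨_, shard870⟩, ⟨_, shard871⟩, ⟨_, shard872⟩,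
    ⟨_, shard873⟩, ⟨_, shard874⟩]

end Summit.KontsevichZagierPeriods.Zeta5Search.Sweep
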